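import Mathlib
import HarnessLib

/-!
# Stub `stub_windowTransform` (P3a) of line `Sketch`, crux stmt-AtomisticToContinuum-13416

This file is stub P3a of line `Sketch` (idea `zero-mean-dyadic-splice`) of the crux
`Summit.AtomisticToContinuum.FouriersLaw.Theses.StaticAbelianSqueeze.UniformAbelianRegularity`
(item stmt-AtomisticToContinuum-13416); it closes nothing by itself. It proves the two bounds on the
cosine transform `Ŵ(ω) = ∫₀^∞ W(t) cos(ωt) dt` of the smooth early window `W(t) = χ(t/τ)(1 − e^{−νt})`
(`χ` the cubic `C¹` smooth-step) consumed by the zero-mean window lemma of `Lines/Sketch.lean`: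
`|Ŵ(ω) + ν/(ν²+ω²)| ≤ 12/(τω²)` (`ω ≠ 0`) and `|∫_{(−δ,δ)} Ŵ| ≤ 12ν(1/δ + 1/(τδ²))` (`δ > 0`).
Engine: `F(z) = ∫₀^τ χ(t/τ) e^{−zt} dt = 1/z + z^{−2}∫_{τ/2}^{τ} q″ e^{−zt}` (two integrations by
parts, `q(t) = χ(t/τ)` the Hermite cubic on `[τ/2, τ]`, `∫|q″| = 6/τ`), so `‖F(z) − 1/z‖ ≤ 6/(τ‖z‖²)`
for `Re z ≥ 0`; `Ŵ(ω) = Re F(iω) − Re F(ν+iω)` and `∫_{(−δ,δ)} Ŵ = 2∫₀^ν Im F(s−iδ) ds` (Fubini twice).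
The smooth-step and the cubic enter as function symbols with defining equations (no definitions).
-/

noncomputable section

namespace Summit.AtomisticToContinuum.FouriersLaw.Theorems.UniformAbelianRegularity.ZeroMeanDyadicSplice

open MeasureTheory Set Filter Topology intervalIntegral Complex

/-- The cubic `C¹` smooth-step `χ` (given by its defining equation) is continuous, `= 1` on
`(−∞, 1/2]`, `= 0` on `[1, ∞)`, and the Hermite cubic on `[1/2, 1]`. [folklore] -/
theorem smoothstep_facts (χ : ℝ → ℝ)
    (hχ : ∀ s, χ s =
      if s ≤ 1 / 2 then 1 else if 1 ≤ s then 0 else 1 - 3 * (2 * s - 1) ^ 2 + 2 * (2 * s - 1) ^ 3) :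
    Continuous χ ∧ (∀ s : ℝ, s ≤ 1 / 2 → χ s = 1) ∧ (∀ s : ℝ, 1 ≤ s → χ s = 0) ∧
      (∀ s : ℝ, 1 / 2 ≤ s → s ≤ 1 → χ s = 1 - 3 * (2 * s - 1) ^ 2 + 2 * (2 * s - 1) ^ 3) := by
  refine ⟨?_, fun s hs => by rw [hχ, if_pos hs], fun s hs => by rw [hχ, if_neg (by linarith), if_pos hs],
    fun s h₁ h₂ => ?_⟩
  · rw [funext hχ]
    refine Continuous.if_le continuous_const ?_ continuous_id continuous_const ?_
    · refine Continuous.if_le continuous_const (by fun_prop) continuous_const continuous_id ?_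
      rintro x rfl
      norm_num
    · rintro x rfl
      norm_num
  · rw [hχ]
    split_ifs with h h'
    · obtain rfl : s = 1 / 2 := le_antisymm h h₁
      norm_num
    · obtain rfl : s = 1 := le_antisymm h₂ h'
      norm_num
    · rfl

/-- The Hermite cubic `q` and its derivatives `q′ = q₁`, `q″ = q₂` (defining equations). [folklore] -/
theorem hasDerivAt_hermite (τ : ℝ) (q q₁ q₂ : ℝ → ℝ)
    (hq : ∀ t, q t = 1 - 3 * (2 * (t / τ) - 1) ^ 2 + 2 * (2 * (t / τ) - 1) ^ 3)
    (hq₁ : ∀ t, q₁ t = 2 / τ * (-6 * (2 * (t / τ) - 1) + 6 * (2 * (t / τ) - 1) ^ 2))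
    (hq₂ : ∀ t, q₂ t = 4 / τ ^ 2 * (-6 + 12 * (2 * (t / τ) - 1))) :
    (∀ t, HasDerivAt q (q₁ t) t) ∧ (∀ t, HasDerivAt q₁ (q₂ t) t) := by
  have hu : ∀ t, HasDerivAt (fun t : ℝ => 2 * (t / τ) - 1) (2 / τ) t := fun t =>
    ((((hasDerivAt_id' t).div_const τ).const_mul 2).sub_const 1).congr_deriv (by ring)
  constructor
  · intro t
    rw [funext hq, hq₁]
    have h := ((((hu t).fun_pow 2).const_mul 3).const_sub 1).fun_add (((hu t).fun_pow 3).const_mul 2)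
    refine h.congr_deriv ?_
    push_cast
    ring
  · intro t
    rw [funext hq₁, hq₂]
    have h := (((hu t).const_mul (-6)).fun_add (((hu t).fun_pow 2).const_mul 6)).const_mul (2 / τ)
    refine h.congr_deriv ?_
    push_cast
    ring

/-- `d/dt (−e^{−zt}/z) = e^{−zt}` for `z ≠ 0` (`t` real). [folklore] -/
theorem hasDerivAt_cexp_primitive {z : ℂ} (hz : z ≠ 0) (t : ℝ) :
    HasDerivAt (fun t : ℝ => -cexp (-(z * t)) / z) (cexp (-(z * t))) t := by
  have h := (((((hasDerivAt_id' t).ofReal_comp.const_mul z).fun_neg).cexp).fun_neg).div_const z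
  refine h.congr_deriv ?_
  field_simp
  push_cast
  ring

/-- Core identity (two integrations by parts on `[τ/2, τ]`, exact integral on `[0, τ/2]`):
`∫₀^τ χ(t/τ) e^{−zt} dt = 1/z + z^{−2} ∫_{τ/2}^{τ} q″(t) e^{−zt} dt` for `z ≠ 0`. [folklore] -/
theorem laplace_smoothstep_eq (χ q q₁ q₂ : ℝ → ℝ)
    (hχ : ∀ s, χ s =
      if s ≤ 1 / 2 then 1 else if 1 ≤ s then 0 else 1 - 3 * (2 * s - 1) ^ 2 + 2 * (2 * s - 1) ^ 3)
    {τ : ℝ} (hτ : 0 < τ)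
    (hq : ∀ t, q t = 1 - 3 * (2 * (t / τ) - 1) ^ 2 + 2 * (2 * (t / τ) - 1) ^ 3)
    (hq₁ : ∀ t, q₁ t = 2 / τ * (-6 * (2 * (t / τ) - 1) + 6 * (2 * (t / τ) - 1) ^ 2))
    (hq₂ : ∀ t, q₂ t = 4 / τ ^ 2 * (-6 + 12 * (2 * (t / τ) - 1))) {z : ℂ} (hz : z ≠ 0) :
    ∫ t in (0:ℝ)..τ, (χ (t / τ) : ℂ) * cexp (-(z * t)) =
      1 / z + 1 / z ^ 2 * ∫ t in (τ / 2)..τ, (q₂ t : ℂ) * cexp (-(z * t)) := by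
  obtain ⟨hχc, hχle, -, hχmid⟩ := smoothstep_facts χ hχ
  obtain ⟨hqd, hq₁d⟩ := hasDerivAt_hermite τ q q₁ q₂ hq hq₁ hq₂
  have hEc : Continuous fun t : ℝ => cexp (-(z * t)) := by fun_prop
  have hVd := hasDerivAt_cexp_primitive hz
  have hχzc : Continuous fun t : ℝ => (χ (t / τ) : ℂ) * cexp (-(z * t)) := by fun_prop
  have hq₁c : Continuous fun t : ℝ => (q₁ t : ℂ) :=
    continuous_ofReal.comp (continuous_iff_continuousAt.2 fun t => (hq₁d t).continuousAt)
  have hq₂c : Continuous fun t : ℝ => (q₂ t : ℂ) := by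
    rw [funext hq₂]
    fun_prop
  have hb : q τ = 0 ∧ q (τ / 2) = 1 ∧ q₁ τ = 0 ∧ q₁ (τ / 2) = 0 := by
    refine ⟨?_, ?_, ?_, ?_⟩ <;>
    · simp only [hq, hq₁]
      field_simp
      ring
  have hsplit : ∫ t in (0:ℝ)..τ, (χ (t / τ) : ℂ) * cexp (-(z * t)) =
      (∫ t in (0:ℝ)..τ / 2, (χ (t / τ) : ℂ) * cexp (-(z * t))) +
        ∫ t in (τ / 2)..τ, (χ (t / τ) : ℂ) * cexp (-(z * t)) :=
    (integral_add_adjacent_intervals (hχzc.intervalIntegrable _ _) (hχzc.intervalIntegrable _ _)).symm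
  have h1 : ∫ t in (0:ℝ)..τ / 2, (χ (t / τ) : ℂ) * cexp (-(z * t)) =
      -cexp (-(z * (τ / 2 : ℝ))) / z - -cexp (-(z * (0 : ℝ))) / z := by
    rw [← integral_eq_sub_of_hasDerivAt (fun t _ => hVd t) (hEc.intervalIntegrable _ _)]
    refine integral_congr fun t ht => ?_
    rw [uIcc_of_le (by positivity)] at ht
    have : χ (t / τ) = 1 := hχle _ (by rw [div_le_iff₀ hτ]; linarith [ht.2])
    simp [this]
  have h2 : ∫ t in (τ / 2)..τ, (χ (t / τ) : ℂ) * cexp (-(z * t)) =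
      ∫ t in (τ / 2)..τ, (q t : ℂ) * cexp (-(z * t)) := by
    refine integral_congr fun t ht => ?_
    rw [uIcc_of_le (by linarith)] at ht
    rw [hq, hχmid _ (by rw [le_div_iff₀ hτ]; linarith [ht.1]) (by rw [div_le_one hτ]; exact ht.2)]
  have hpull : ∀ g : ℝ → ℝ, ∫ t in (τ / 2)..τ, (g t : ℂ) * (-cexp (-(z * t)) / z) =
      -(1 / z) * ∫ t in (τ / 2)..τ, (g t : ℂ) * cexp (-(z * t)) := fun g => by
    rw [← intervalIntegral.integral_const_mul]
    exact integral_congr fun t _ => by ring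
  have hibp1 : ∫ t in (τ / 2)..τ, (q t : ℂ) * cexp (-(z * t)) =
      (q τ : ℂ) * (-cexp (-(z * (τ : ℝ))) / z) - (q (τ / 2) : ℂ) * (-cexp (-(z * (τ / 2 : ℝ))) / z) -
        ∫ t in (τ / 2)..τ, (q₁ t : ℂ) * (-cexp (-(z * t)) / z) :=
    integral_mul_deriv_eq_deriv_mul (u := fun t => (q t : ℂ)) (fun t _ => (hqd t).ofReal_comp)
      (fun t _ => hVd t) (hq₁c.intervalIntegrable _ _) (hEc.intervalIntegrable _ _)
  have hibp2 : ∫ t in (τ / 2)..τ, (q₁ t : ℂ) * cexp (-(z * t)) =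
      (q₁ τ : ℂ) * (-cexp (-(z * (τ : ℝ))) / z) - (q₁ (τ / 2) : ℂ) * (-cexp (-(z * (τ / 2 : ℝ))) / z) -
        ∫ t in (τ / 2)..τ, (q₂ t : ℂ) * (-cexp (-(z * t)) / z) :=
    integral_mul_deriv_eq_deriv_mul (u := fun t => (q₁ t : ℂ)) (fun t _ => (hq₁d t).ofReal_comp)
      (fun t _ => hVd t) (hq₂c.intervalIntegrable _ _) (hEc.intervalIntegrable _ _)
  rw [hsplit, h1, h2, hibp1, hpull, hibp2, hpull, hb.1, hb.2.1, hb.2.2.1, hb.2.2.2]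
  simp only [ofReal_zero, ofReal_one, mul_zero, neg_zero, Complex.exp_zero, zero_mul, one_mul, zero_sub]
  field_simp
  ring

/-- Core bound: `‖∫₀^τ χ(t/τ) e^{−zt} dt − 1/z‖ ≤ 6/(τ‖z‖²)` for `z ≠ 0`, `Re z ≥ 0` (`|e^{−zt}| ≤ 1`
and `∫_{τ/2}^{τ} |q″| = 6/τ`, splitting at the sign change `t = 3τ/4` of `q″`). [folklore] -/
theorem norm_laplace_smoothstep_sub_inv_le (χ : ℝ → ℝ)
    (hχ : ∀ s, χ s =
      if s ≤ 1 / 2 then 1 else if 1 ≤ s then 0 else 1 - 3 * (2 * s - 1) ^ 2 + 2 * (2 * s - 1) ^ 3)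
    {τ : ℝ} (hτ : 0 < τ) {z : ℂ} (hz : z ≠ 0) (hre : 0 ≤ z.re) :
    ‖(∫ t in (0:ℝ)..τ, (χ (t / τ) : ℂ) * cexp (-(z * t))) - 1 / z‖ ≤ 6 / (τ * ‖z‖ ^ 2) := by
  obtain ⟨q, hq⟩ : ∃ q : ℝ → ℝ, ∀ t, q t = 1 - 3 * (2 * (t / τ) - 1) ^ 2 + 2 * (2 * (t / τ) - 1) ^ 3 :=
    ⟨_, fun _ => rfl⟩
  obtain ⟨q₁, hq₁⟩ : ∃ q₁ : ℝ → ℝ, ∀ t,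
      q₁ t = 2 / τ * (-6 * (2 * (t / τ) - 1) + 6 * (2 * (t / τ) - 1) ^ 2) := ⟨_, fun _ => rfl⟩
  obtain ⟨q₂, hq₂⟩ : ∃ q₂ : ℝ → ℝ, ∀ t, q₂ t = 4 / τ ^ 2 * (-6 + 12 * (2 * (t / τ) - 1)) :=
    ⟨_, fun _ => rfl⟩
  obtain ⟨-, hq₁d⟩ := hasDerivAt_hermite τ q q₁ q₂ hq hq₁ hq₂
  rw [laplace_smoothstep_eq χ q q₁ q₂ hχ hτ hq hq₁ hq₂ hz, add_sub_cancel_left, norm_mul, norm_div,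
    norm_one, norm_pow]
  have hq₂c : Continuous q₂ := by
    rw [funext hq₂]
    fun_prop
  have hc : Continuous fun t : ℝ => (q₂ t : ℂ) * cexp (-(z * t)) := by fun_prop
  -- `‖∫_a^b q″ e^{−zt}‖ ≤ ε (q′ b − q′ a)` when `|q″| = ε q″` on `(a, b]`, `a ≥ 0`
  have half : ∀ a b ε : ℝ, 0 ≤ a → a ≤ b → (∀ t ∈ Ioc a b, |q₂ t| = ε * q₂ t) →
      ‖∫ t in a..b, (q₂ t : ℂ) * cexp (-(z * t))‖ ≤ ε * (q₁ b - q₁ a) := by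
    intro a b ε ha hab hε
    rw [← integral_eq_sub_of_hasDerivAt (fun t _ => hq₁d t) (hq₂c.intervalIntegrable _ _),
      ← intervalIntegral.integral_const_mul]
    refine norm_integral_le_of_norm_le hab (ae_of_all _ fun t ht => ?_)
      ((hq₂c.const_mul ε).intervalIntegrable _ _)
    rw [← hε t ht, norm_mul, norm_real, Real.norm_eq_abs, Complex.norm_exp]
    refine mul_le_of_le_one_right (abs_nonneg _) (Real.exp_le_one_iff.mpr ?_)
    simp only [neg_re, mul_re, ofReal_re, ofReal_im, mul_zero, sub_zero, Left.neg_nonpos_iff]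
    exact mul_nonneg hre (by linarith [ht.1])
  have hA : ‖∫ t in (τ / 2)..(3 * τ / 4), (q₂ t : ℂ) * cexp (-(z * t))‖ ≤ 3 / τ := by
    refine (half _ _ (-1) (by positivity) (by linarith) fun t ht => ?_).trans (le_of_eq ?_)
    · have h4 : t / τ ≤ 3 / 4 := by rw [div_le_iff₀ hτ]; linarith [ht.2]
      have hq₂t : q₂ t ≤ 0 := by
        rw [hq₂]; exact mul_nonpos_of_nonneg_of_nonpos (by positivity) (by linarith)
      rw [abs_of_nonpos hq₂t]
      ring
    · simp only [hq₁]
      field_simp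
      ring
  have hB : ‖∫ t in (3 * τ / 4)..τ, (q₂ t : ℂ) * cexp (-(z * t))‖ ≤ 3 / τ := by
    refine (half _ _ 1 (by positivity) (by linarith) fun t ht => ?_).trans (le_of_eq ?_)
    · have h4 : 3 / 4 ≤ t / τ := by rw [le_div_iff₀ hτ]; linarith [ht.1]
      rw [abs_of_nonneg (by rw [hq₂]; exact mul_nonneg (by positivity) (by linarith)), one_mul]
    · simp only [hq₁]
      field_simp
      ring
  rw [← integral_add_adjacent_intervals (b := 3 * τ / 4) (hc.intervalIntegrable _ _)
    (hc.intervalIntegrable _ _)]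
  have hz2 : 0 < ‖z‖ ^ 2 := by positivity
  calc 1 / ‖z‖ ^ 2 * ‖(∫ t in (τ / 2)..(3 * τ / 4), (q₂ t : ℂ) * cexp (-(z * t))) +
        ∫ t in (3 * τ / 4)..τ, (q₂ t : ℂ) * cexp (-(z * t))‖ ≤ 1 / ‖z‖ ^ 2 * (3 / τ + 3 / τ) := by
        gcongr
        exact (norm_add_le _ _).trans (add_le_add hA hB)
    _ = 6 / (τ * ‖z‖ ^ 2) := by
        field_simp
        ring

/-- Real form of the core bound at `z = a − ib` (`a ≥ 0`, `(a,b) ≠ 0`): the cosine/sine transforms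
`∫₀^τ χ(t/τ) e^{−at} cos(bt)`, `∫₀^τ χ(t/τ) e^{−at} sin(bt)` are within `6/(τ(a²+b²))` of `a/(a²+b²)`,
`b/(a²+b²)`. [folklore] -/
theorem smoothstep_cos_sin_bounds (χ : ℝ → ℝ)
    (hχ : ∀ s, χ s =
      if s ≤ 1 / 2 then 1 else if 1 ≤ s then 0 else 1 - 3 * (2 * s - 1) ^ 2 + 2 * (2 * s - 1) ^ 3)
    {τ : ℝ} (hτ : 0 < τ) {a b : ℝ} (ha : 0 ≤ a) (hab : 0 < a ^ 2 + b ^ 2) :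
    |(∫ t in (0:ℝ)..τ, χ (t / τ) * (Real.exp (-(a * t)) * Real.cos (b * t))) -
        a / (a ^ 2 + b ^ 2)| ≤ 6 / (τ * (a ^ 2 + b ^ 2)) ∧
    |(∫ t in (0:ℝ)..τ, χ (t / τ) * (Real.exp (-(a * t)) * Real.sin (b * t))) -
        b / (a ^ 2 + b ^ 2)| ≤ 6 / (τ * (a ^ 2 + b ^ 2)) := by
  set z : ℂ := ⟨a, -b⟩ with hz
  have hzre : z.re = a := rfl
  have hzim : z.im = -b := rfl
  have hnormSq : normSq z = a ^ 2 + b ^ 2 := by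
    rw [normSq_apply, hzre, hzim]
    ring
  have hz0 : z ≠ 0 := fun h => hab.ne' (by rw [← hnormSq, h, map_zero])
  have key := norm_laplace_smoothstep_sub_inv_le χ hχ hτ hz0 (hzre ▸ ha)
  rw [Complex.sq_norm, hnormSq] at key
  have hχc := (smoothstep_facts χ hχ).1
  have hint : IntervalIntegrable (fun t : ℝ => (χ (t / τ) : ℂ) * cexp (-(z * t))) volume 0 τ :=
    (by fun_prop : Continuous fun t : ℝ => (χ (t / τ) : ℂ) * cexp (-(z * t))).intervalIntegrable _ _
  have hre_int : (∫ t in (0:ℝ)..τ, (χ (t / τ) : ℂ) * cexp (-(z * t))).re =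
      ∫ t in (0:ℝ)..τ, χ (t / τ) * (Real.exp (-(a * t)) * Real.cos (b * t)) := by
    rw [← RCLike.re_to_complex, ← intervalIntegral_re hint]
    refine integral_congr fun t _ => ?_
    rw [RCLike.re_to_complex, re_ofReal_mul, exp_re]
    simp [hzre, hzim]
  have him_int : (∫ t in (0:ℝ)..τ, (χ (t / τ) : ℂ) * cexp (-(z * t))).im =
      ∫ t in (0:ℝ)..τ, χ (t / τ) * (Real.exp (-(a * t)) * Real.sin (b * t)) := by
    rw [← RCLike.im_to_complex, ← intervalIntegral_im hint]
    refine integral_congr fun t _ => ?_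
    rw [RCLike.im_to_complex, im_ofReal_mul, exp_im]
    simp [hzre, hzim]
  have hinv_re : (1 / z).re = a / (a ^ 2 + b ^ 2) := by rw [one_div, inv_re, hnormSq, hzre]
  have hinv_im : (1 / z).im = b / (a ^ 2 + b ^ 2) := by rw [one_div, inv_im, hnormSq, hzim, neg_neg]
  refine ⟨?_, ?_⟩
  · rw [← hre_int, ← hinv_re, ← sub_re]
    exact (abs_re_le_norm _).trans key
  · rw [← him_int, ← hinv_im, ← sub_im]
    exact (abs_im_le_norm _).trans key

/-- **Stub `stub_windowTransform` (P3a of line `Sketch`; cosine transform of the explicit early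
window).** For `ν, τ > 0`, the window `W(t) = χ(t/τ)(1 − e^{−νt})` (`χ` the cubic smooth-step) has
cosine transform `Ŵ(ω) = ∫₀^∞ W(t) cos(ωt) dt` with `|Ŵ(ω) + ν/(ν²+ω²)| ≤ 12/(τ ω²)` (`ω ≠ 0`) and
`|∫_{(−δ,δ)} Ŵ(ω) dω| ≤ 12 ν (1/δ + 1/(τδ²))` (`δ > 0`): `Ŵ(ω) = Re F(iω) − Re F(ν+iω)` and
`∫_{(−δ,δ)} Ŵ = 2 ∫₀^ν Im F(s − iδ) ds` (Fubini twice, `1 − e^{−νt} = ∫₀^ν t e^{−st} ds`,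
`t ∫_{−δ}^{δ} cos(ωt) dω = 2 sin(δt)`), with `‖F(z) − 1/z‖ ≤ 6/(τ‖z‖²)`. [folklore] -/
theorem stub_windowTransform :
    ∀ ν τ : ℝ, 0 < ν → 0 < τ →
      let χ : ℝ → ℝ := fun s => if s ≤ 1 / 2 then 1 else if 1 ≤ s then 0 else 1 - 3 * (2 * s - 1) ^ 2 + 2 * (2 * s - 1) ^ 3
      let Wc : ℝ → ℝ := fun ω => ∫ t in Set.Ioi (0:ℝ), (χ (t / τ) * (1 - Real.exp (-(ν * t)))) * Real.cos (ω * t)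
      (∀ ω : ℝ, ω ≠ 0 → |Wc ω + ν / (ν ^ 2 + ω ^ 2)| ≤ 12 / (τ * ω ^ 2)) ∧
      (∀ δ : ℝ, 0 < δ → |∫ ω in Set.Ioo (-δ) δ, Wc ω| ≤ 12 * ν * (1 / δ + 1 / (τ * δ ^ 2))) := by
  intro ν τ hν hτ χ Wc
  have hχ : ∀ s, χ s =
      if s ≤ 1 / 2 then 1 else if 1 ≤ s then 0 else 1 - 3 * (2 * s - 1) ^ 2 + 2 * (2 * s - 1) ^ 3 :=
    fun s => rfl
  obtain ⟨hχc, -, hχ0, -⟩ := smoothstep_facts χ hχ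
  -- the window vanishes on `[τ, ∞)`: `Ŵ(ω)` is an integral over `(0, τ]`
  have hW : ∀ ω, Wc ω =
      ∫ t in Ioc (0:ℝ) τ, χ (t / τ) * (1 - Real.exp (-(ν * t))) * Real.cos (ω * t) := by
    refine fun ω => setIntegral_eq_of_subset_of_forall_sdiff_eq_zero measurableSet_Ioi
      Ioc_subset_Ioi_self fun t ht => ?_
    have ht' : τ < t := by
      rcases ht with ⟨h1, h2⟩
      by_contra h
      exact h2 ⟨h1, not_lt.mp h⟩
    rw [hχ0 _ ((one_le_div hτ).mpr ht'.le)]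
    simp
  simp only [hW]
  clear hW Wc
  clear_value χ
  -- Fubini tool: continuous integrands on products of bounded intervals
  have hInt : ∀ f : ℝ → ℝ → ℝ, Continuous (fun p : ℝ × ℝ => f p.1 p.2) → ∀ a b c d : ℝ,
      Integrable (Function.uncurry f)
        ((volume.restrict (Ioc a b)).prod (volume.restrict (Ioc c d))) := by
    intro f hf a b c d
    rw [Measure.prod_restrict, ← Measure.volume_eq_prod]
    exact (hf.continuousOn.integrableOn_compact (isCompact_Icc.prod isCompact_Icc)).mono_set
      (Set.prod_mono Ioc_subset_Icc_self Ioc_subset_Icc_self)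
  constructor
  · -- (b2): `Ŵ(ω) = Re F(iω) − Re F(ν+iω)`
    intro ω hω
    rw [← intervalIntegral.integral_of_le hτ.le]
    have hω2 : 0 < (0:ℝ) ^ 2 + ω ^ 2 := by positivity
    have hA := (smoothstep_cos_sin_bounds χ hχ hτ le_rfl hω2).1
    norm_num at hA
    have hB := (smoothstep_cos_sin_bounds χ hχ hτ hν.le (b := ω) (by positivity)).1
    have hsplit : ∫ t in (0:ℝ)..τ, χ (t / τ) * (1 - Real.exp (-(ν * t))) * Real.cos (ω * t) =
        (∫ t in (0:ℝ)..τ, χ (t / τ) * Real.cos (ω * t)) -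
          ∫ t in (0:ℝ)..τ, χ (t / τ) * (Real.exp (-(ν * t)) * Real.cos (ω * t)) := by
      rw [← intervalIntegral.integral_sub
        ((by fun_prop : Continuous fun t : ℝ => χ (t / τ) * Real.cos (ω * t)).intervalIntegrable _ _)
        ((by fun_prop : Continuous fun t : ℝ =>
          χ (t / τ) * (Real.exp (-(ν * t)) * Real.cos (ω * t))).intervalIntegrable _ _)]
      exact integral_congr fun t _ => by ring
    rw [hsplit]
    have h6 : 6 / (τ * (ν ^ 2 + ω ^ 2)) ≤ 6 / (τ * ω ^ 2) :=
      div_le_div_of_nonneg_left (by norm_num) (by positivity) (by nlinarith [sq_nonneg ν])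
    have h12 : (12 : ℝ) / (τ * ω ^ 2) = 6 / (τ * ω ^ 2) + 6 / (τ * ω ^ 2) := by ring
    obtain ⟨hA1, hA2⟩ := abs_le.mp hA
    obtain ⟨hB1, hB2⟩ := abs_le.mp hB
    exact abs_le.mpr ⟨by linarith, by linarith⟩
  · -- (b3): `∫_{(−δ,δ)} Ŵ = 2 ∫₀^ν Im F(s − iδ) ds`
    intro δ hδ
    rw [← integral_Ioc_eq_integral_Ioo, integral_integral_swap
      (hInt (fun ω t => χ (t / τ) * (1 - Real.exp (-(ν * t))) * Real.cos (ω * t)) (by fun_prop) _ _ _ _)]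
    -- the inner `ω`-integral, rewritten as an `s`-integral over `(0, ν]`
    have hpt : ∀ t : ℝ, ∫ ω in Ioc (-δ) δ, χ (t / τ) * (1 - Real.exp (-(ν * t))) * Real.cos (ω * t) =
        ∫ s in Ioc (0:ℝ) ν, 2 * (χ (t / τ) * (Real.exp (-(s * t)) * Real.sin (δ * t))) := by
      intro t
      rw [MeasureTheory.integral_const_mul, ← intervalIntegral.integral_of_le (by linarith : -δ ≤ δ),
        ← intervalIntegral.integral_of_le hν.le]
      have hJc : t * ∫ ω in (-δ)..δ, Real.cos (ω * t) = 2 * Real.sin (δ * t) := by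
        rw [← smul_eq_mul, intervalIntegral.smul_integral_comp_mul_right, integral_cos, neg_mul,
          Real.sin_neg]
        ring
      have hd : ∀ s : ℝ, HasDerivAt (fun s : ℝ => -Real.exp (-(s * t))) (t * Real.exp (-(s * t))) s :=
        fun s => ((((hasDerivAt_id' s).mul_const t).fun_neg.exp).fun_neg).congr_deriv (by ring)
      have hJe : ∫ s in (0:ℝ)..ν, t * Real.exp (-(s * t)) = 1 - Real.exp (-(ν * t)) := by
        rw [integral_eq_sub_of_hasDerivAt (fun s _ => hd s)
          ((by fun_prop : Continuous fun s : ℝ => t * Real.exp (-(s * t))).intervalIntegrable _ _)]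
        simp only [zero_mul, neg_zero, Real.exp_zero]
        ring
      calc χ (t / τ) * (1 - Real.exp (-(ν * t))) * ∫ ω in (-δ)..δ, Real.cos (ω * t)
          = χ (t / τ) * (∫ s in (0:ℝ)..ν, Real.exp (-(s * t))) *
              (t * ∫ ω in (-δ)..δ, Real.cos (ω * t)) := by
            rw [← hJe, intervalIntegral.integral_const_mul]
            ring
        _ = ∫ s in (0:ℝ)..ν, 2 * (χ (t / τ) * (Real.exp (-(s * t)) * Real.sin (δ * t))) := by
            rw [hJc, ← intervalIntegral.integral_const_mul, ← intervalIntegral.integral_mul_const]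
            exact integral_congr fun s _ => by ring
    simp_rw [hpt]
    rw [integral_integral_swap (hInt (fun t s =>
      2 * (χ (t / τ) * (Real.exp (-(s * t)) * Real.sin (δ * t)))) (by fun_prop) _ _ _ _)]
    -- bound on the inner `t`-integral for `s ∈ (0, ν]`: `2 |Im F(s − iδ)| ≤ 2 (1/δ + 6/(τδ²))`
    have hinner : ∀ s ∈ Ioc (0:ℝ) ν,
        ‖∫ t in Ioc (0:ℝ) τ, 2 * (χ (t / τ) * (Real.exp (-(s * t)) * Real.sin (δ * t)))‖ ≤
          2 * (1 / δ + 6 / (τ * δ ^ 2)) := by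
      intro s hs
      rw [MeasureTheory.integral_const_mul, ← intervalIntegral.integral_of_le hτ.le, norm_mul,
        Real.norm_eq_abs, Real.norm_eq_abs, abs_two]
      have hsd : 0 < s ^ 2 + δ ^ 2 := by positivity
      obtain ⟨hG1, hG2⟩ := abs_le.mp (smoothstep_cos_sin_bounds χ hχ hτ hs.1.le hsd).2
      have h0 : 0 ≤ δ / (s ^ 2 + δ ^ 2) := by positivity
      have h1 : δ / (s ^ 2 + δ ^ 2) ≤ 1 / δ := by
        rw [div_le_div_iff₀ hsd hδ]
        nlinarith [sq_nonneg s]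
      have h2 : 6 / (τ * (s ^ 2 + δ ^ 2)) ≤ 6 / (τ * δ ^ 2) :=
        div_le_div_of_nonneg_left (by norm_num) (by positivity) (by nlinarith [sq_nonneg s])
      have hG : |∫ t in (0:ℝ)..τ, χ (t / τ) * (Real.exp (-(s * t)) * Real.sin (δ * t))| ≤
          1 / δ + 6 / (τ * δ ^ 2) := abs_le.mpr ⟨by linarith, by linarith⟩
      linarith
    rw [← Real.norm_eq_abs]
    refine (norm_setIntegral_le_of_norm_le_const measure_Ioc_lt_top hinner).trans ?_
    rw [Real.volume_real_Ioc_of_le hν.le, sub_zero]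
    have h10 : 0 ≤ 10 * ν / δ := by positivity
    have e : 12 * ν * (1 / δ + 1 / (τ * δ ^ 2)) = 2 * (1 / δ + 6 / (τ * δ ^ 2)) * ν + 10 * ν / δ := by
      ring
    rw [e]
    linarith

end Summit.AtomisticToContinuum.FouriersLaw.Theorems.UniformAbelianRegularity.ZeroMeanDyadicSplice

end
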